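import Summits.SmoothPoincare4.SmoothPoincare4.Theses.SblfDescent
import Summits.SmoothPoincare4.SmoothPoincare4.Theorems.SblfDescentStepTwoReduction
import Summits.SmoothPoincare4.SmoothPoincare4.Theorems.SblfDescentRungOne
import Summits.SmoothPoincare4.SmoothPoincare4.Theorems.SblfDescentSblfExistsShield
import Summits.SmoothPoincare4.SmoothPoincare4.Theorems.StepTwo.Negative.SameMapObstruction
import Literature.Topology.FourManifolds.SimplifiedBrokenLefschetzFibration
import Literature.Topology.FourManifolds.GenusOneSblfOnSphereFourProofs
import Literature.Topology.FourManifolds.SphereFourFibredRegluing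

/-!
# F4 ON-PATH lemma for line `fibred_regluing` (crux `SblfDescent.StepTwo`, stmt-SmoothPoincare4-18529) —
rung `TorusRegluingRecognition = FibredRegluingRecognition 1`, gap `TorusRegluingOfSphereFour`.

`SmoothPoincare4 → FibredRegluingRecognition h` for every `h` (the fibration data are discarded) and
`SmoothPoincare4 → RegluingOfSphereFour h` (transport the fibration to `S⁴` by the diffeomorphism and
restrict it off the fibre): both stubs of the line are consequences of the summit, so refuting either
exhibits an exotic 4-sphere; the [nec]-trap is discharged by the F3 witness (`Lines/TorusRegluingRecognition_special.lean`:
the family is pinned to the proved floor `h = 0`).  Definitions verbatim from `Lines/fibred_regluing.lean`.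
Also published here, sorry-free: NECESSITY of the gap (`torusRegluingOfSphereFour_of_stepTwo_of_rungOne`:
StepTwo ∧ RungOne ⇒ gap), SUFFICIENCY (`genusTwoRecognition_of_regluing`: gap ∧ rung ⇒ genus-2 recognition) and the
ladder composition with the stub statements as hypotheses (`stepTwo_of_regluing`: gap → rung → StepTwo).
No `sorry`.
-/

set_option linter.dupNamespace false

namespace Summit.SmoothPoincare4.SmoothPoincare4.Cruxes.StepTwo.FibredRegluing

open scoped Manifold ContDiff Topology ContinuousMap
open Literature.Topology.FourManifolds
open Summit.SmoothPoincare4.SmoothPoincare4.Theses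
open Summit.SmoothPoincare4.SmoothPoincare4.Theorems

/-- Local notation: the round spheres `S⁴ ⊂ ℝ⁵`, `S² ⊂ ℝ³`. -/
local notation "𝕊⁴" => Metric.sphere (0 : EuclideanSpace ℝ (Fin 5)) 1
local notation "𝕊²" => Metric.sphere (0 : EuclideanSpace ℝ (Fin 3)) 1

/-- `y` is a LOWER regular value of `f` (lower genus `h`): every point over `y` is regular and the fibre
has `H₁ ≅ ℤ^{2h}` — verbatim the clause of `IsSimplifiedBrokenLefschetzFibration.exists_lower`. -/
def IsLowerRegularValue {X : Type} [TopologicalSpace X] [ChartedSpace (EuclideanSpace ℝ (Fin 4)) X]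
    (f : X → 𝕊²) (h : ℕ) (y : 𝕊²) : Prop :=
  (∀ q, f q = y → Function.Surjective (mfderiv (𝓡 4) (𝓡 2) f q)) ∧
    Nonempty ((Fin (2 * h) → ℤ) ≃ₗ[ℤ]
      Literature.AlgebraicTopology.SingularHomology.singularHomology ℤ ℤ ↥(f ⁻¹' {y}) 1)

/-- FIBRED AGREEMENT OFF THE FIBRE OVER `y₀`: `Ψ` is a diffeomorphism from `X ∖ f⁻¹{y₀}` onto
`Y ∖ f₀⁻¹{y₀}` with `f₀ ∘ Ψ = f` there.  ("`(X, f)` is `(Y, f₀)` reglued along the fibre over `y₀`.") -/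
def IsFibredAgreementOff {X Y : Type} [TopologicalSpace X] [ChartedSpace (EuclideanSpace ℝ (Fin 4)) X]
    [TopologicalSpace Y] [ChartedSpace (EuclideanSpace ℝ (Fin 4)) Y]
    (f : X → 𝕊²) (f₀ : Y → 𝕊²) (y₀ : 𝕊²) (Ψ : OpenPartialHomeomorph X Y) : Prop :=
  Ψ.source = (f ⁻¹' {y₀})ᶜ ∧ Ψ.target = (f₀ ⁻¹' {y₀})ᶜ ∧
    ContMDiffOn (𝓡 4) (𝓡 4) ∞ Ψ Ψ.source ∧ ContMDiffOn (𝓡 4) (𝓡 4) ∞ Ψ.symm Ψ.target ∧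
    ∀ x ∈ Ψ.source, f₀ (Ψ x) = f x

/-- RUNG FAMILY (gluing-genus dial, recognition form): a smooth homotopy 4-sphere `X` carrying a
simplified broken Lefschetz fibration `f` of lower genus `h` which agrees, off the fibre over a
lower-regular value `y₀`, with a simplified broken Lefschetz fibration `f₀` of lower genus `h` of the
ROUND sphere, is diffeomorphic to `S⁴`.  `h = 0` ⟸ `RungOne` (`fibredRegluingRecognition_zero_of_rungOne`);
`h ≥ 2`: in print (Baykur–Hayano Thm. 3.9: the Hurwitz systems agree, `Diff₀(Σ_h)` contractible);
`h = 1` = `TorusRegluingRecognition`, THE RUNG. -/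
def FibredRegluingRecognition (h : ℕ) : Prop :=
  ∀ (X : Type) [TopologicalSpace X] [T2Space X] [SecondCountableTopology X]
    [ChartedSpace (EuclideanSpace ℝ (Fin 4)) X] [IsManifold (𝓡 4) ((⊤ : ℕ∞) : WithTop ℕ∞) X],
    X ≃ₕ 𝕊⁴ →
    ∀ f : X → 𝕊², (∃ (o : SmoothOrientation (𝓡 4) X) (L : Finset X),
      IsSimplifiedBrokenLefschetzFibration o f L h) →
    ∀ f₀ : 𝕊⁴ → 𝕊², (∃ (o₀ : SmoothOrientation (𝓡 4) 𝕊⁴) (L₀ : Finset 𝕊⁴),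
      IsSimplifiedBrokenLefschetzFibration o₀ f₀ L₀ h) →
    ∀ y₀ : 𝕊², IsLowerRegularValue f h y₀ →
    ∀ Ψ : OpenPartialHomeomorph X 𝕊⁴, IsFibredAgreementOff f f₀ y₀ Ψ →
    Nonempty (Diffeomorph (𝓡 4) (𝓡 4) X 𝕊⁴ ((⊤ : ℕ∞) : WithTop ℕ∞))

/-- THE RUNG (`h = 1`): a homotopy 4-sphere obtained from a genus-2 simplified broken Lefschetz
fibration of `S⁴` by one fibred regluing of the lower side `T² × D²` — i.e. by ONE multiplicity-one
logarithmic transformation along a lower torus fibre — is `S⁴`.  (For every direction `(a,b)`: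
directions changing the homotopy type are excluded by the hypothesis `X ≃ₕ S⁴`.) -/
def TorusRegluingRecognition : Prop := FibredRegluingRecognition 1

/-- GAP FAMILY: every simplified broken Lefschetz fibration of lower genus `h` on a smooth homotopy
4-sphere is a fibred regluing, along the fibre over one of ITS lower-regular values, of a simplified
broken Lefschetz fibration of lower genus `h` of the round `S⁴`.  (A consequence of the summit by
transport — `regluingOfSphereFour_of_recognition`; as a statement short of it: a census of genus-`(h+1)`
Hurwitz systems of homotopy spheres — all realised on `S⁴` — plus Baykur–Hayano-type uniqueness of the
higher side and round cobordism.) -/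
def RegluingOfSphereFour (h : ℕ) : Prop :=
  ∀ (X : Type) [TopologicalSpace X] [T2Space X] [SecondCountableTopology X]
    [ChartedSpace (EuclideanSpace ℝ (Fin 4)) X] [IsManifold (𝓡 4) ((⊤ : ℕ∞) : WithTop ℕ∞) X],
    X ≃ₕ 𝕊⁴ →
    ∀ f : X → 𝕊², (∃ (o : SmoothOrientation (𝓡 4) X) (L : Finset X),
      IsSimplifiedBrokenLefschetzFibration o f L h) →
    ∃ f₀ : 𝕊⁴ → 𝕊², (∃ (o₀ : SmoothOrientation (𝓡 4) 𝕊⁴) (L₀ : Finset 𝕊⁴),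
      IsSimplifiedBrokenLefschetzFibration o₀ f₀ L₀ h) ∧
      ∃ y₀ : 𝕊², IsLowerRegularValue f h y₀ ∧
        ∃ Ψ : OpenPartialHomeomorph X 𝕊⁴, IsFibredAgreementOff f f₀ y₀ Ψ

/-- THE GAP at `h = 1` (to `StepTwo`): every genus-2 simplified broken Lefschetz fibration on a homotopy
4-sphere is a fibred torus regluing (one multiplicity-one log transform along a lower torus fibre) of a
genus-2 simplified broken Lefschetz fibration of `S⁴`. -/
def TorusRegluingOfSphereFour : Prop := RegluingOfSphereFour 1

/-- F4 ON-PATH: every rung of the family is a consequence of the summit (all fibration data are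
discarded), so refuting `FibredRegluingRecognition h` exhibits an exotic 4-sphere. [this file] -/
theorem fibredRegluingRecognition_of_smoothPoincare4 (hS : _root_.SmoothPoincare4) (h : ℕ) :
    FibredRegluingRecognition h := by
  intro X _ _ _ _ _ e _ _ _ _ _ _ _ _
  exact hS X ‹_› ‹_› e

/-- The rung is on-path. [this file] -/
theorem torusRegluingRecognition_of_smoothPoincare4 (hS : _root_.SmoothPoincare4) :
    TorusRegluingRecognition :=
  fibredRegluingRecognition_of_smoothPoincare4 hS 1

/-- TRANSPORT: if every homotopy 4-sphere carrying a lower-genus-`h` SBLF is diffeomorphic to `S⁴`,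
then every such SBLF is a fibred regluing of its own transport to `S⁴` (`Ψ` = the diffeomorphism
restricted off the fibre).  Gives the on-path lemma for the gap and its necessity for `StepTwo`. [this file] -/
theorem regluingOfSphereFour_of_recognition (h : ℕ)
    (hR : ∀ (X : Type) [TopologicalSpace X] [T2Space X] [SecondCountableTopology X]
      [ChartedSpace (EuclideanSpace ℝ (Fin 4)) X] [IsManifold (𝓡 4) ((⊤ : ℕ∞) : WithTop ℕ∞) X],
      X ≃ₕ 𝕊⁴ →
      (∃ (o : SmoothOrientation (𝓡 4) X) (f : X → 𝕊²) (L : Finset X),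
          IsSimplifiedBrokenLefschetzFibration o f L h) →
      Nonempty (Diffeomorph (𝓡 4) (𝓡 4) X 𝕊⁴ ((⊤ : ℕ∞) : WithTop ℕ∞))) :
    RegluingOfSphereFour h := by
  intro X _ _ _ _ _ e f hf
  obtain ⟨o, L, hf⟩ := hf
  obtain ⟨Φ⟩ := hR X e ⟨o, f, L, hf⟩
  obtain ⟨y₀, hy₀⟩ := hf.exists_lower
  have hcont : Continuous f := hf.contMDiff.continuous
  have hopen : IsOpen (f ⁻¹' {y₀})ᶜ := ((isClosed_singleton).preimage hcont).isOpen_compl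
  have hcont₀ : Continuous (f ∘ Φ.symm) := hcont.comp Φ.symm.continuous
  have hopen₀ : IsOpen ((f ∘ Φ.symm) ⁻¹' {y₀})ᶜ := ((isClosed_singleton).preimage hcont₀).isOpen_compl
  let Ψ : OpenPartialHomeomorph X 𝕊⁴ :=
    { toFun := Φ
      invFun := Φ.symm
      source := (f ⁻¹' {y₀})ᶜ
      target := ((f ∘ Φ.symm) ⁻¹' {y₀})ᶜ
      map_source' := by
        intro x hx
        simpa [Set.mem_compl_iff, Set.mem_preimage, Function.comp, Diffeomorph.symm_apply_apply] using hx
      map_target' := by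
        intro y hy
        simpa [Set.mem_compl_iff, Set.mem_preimage, Function.comp] using hy
      left_inv' := by intro x _; simp
      right_inv' := by intro y _; simp
      open_source := hopen
      open_target := hopen₀
      continuousOn_toFun := Φ.continuous.continuousOn
      continuousOn_invFun := Φ.symm.continuous.continuousOn }
  refine ⟨f ∘ Φ.symm, ⟨_, _, sblf_comp_diffeomorph Φ.symm hf⟩, y₀, hy₀, Ψ, rfl, rfl, ?_, ?_, ?_⟩
  · exact Φ.contMDiff.contMDiffOn
  · exact Φ.symm.contMDiff.contMDiffOn
  · intro x _
    show f (Φ.symm (Φ x)) = f x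
    simp

/-- F4 for the gap: `RegluingOfSphereFour h` is a consequence of the summit. [this file] -/
theorem regluingOfSphereFour_of_smoothPoincare4 (hS : _root_.SmoothPoincare4) (h : ℕ) :
    RegluingOfSphereFour h :=
  regluingOfSphereFour_of_recognition h (fun X _ _ _ _ _ e _ => hS X ‹_› ‹_› e)

/-- NECESSITY of the gap for the crux: `StepTwo` and the floor `RungOne` give `TorusRegluingOfSphereFour`
(through the landed `genusTwoRecognition_of_stepTwo_of_rungOne`). [this file] -/
theorem torusRegluingOfSphereFour_of_stepTwo_of_rungOne (h2 : SblfDescent.StepTwo)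
    (h1 : SblfDescent.RungOne) : TorusRegluingOfSphereFour :=
  regluingOfSphereFour_of_recognition 1 (genusTwoRecognition_of_stepTwo_of_rungOne h2 h1)

/-- Genus-2 recognition (the apex of line `Sketch`; `= StepTwo` modulo the ADK and Hayano facts by
`stepTwo_iff_genusTwoRecognition`) from the gap + the rung. [this file] -/
theorem genusTwoRecognition_of_regluing (hA : TorusRegluingOfSphereFour)
    (hR : TorusRegluingRecognition) :
    ∀ (X : Type) [TopologicalSpace X] [T2Space X] [SecondCountableTopology X]
      [ChartedSpace (EuclideanSpace ℝ (Fin 4)) X] [IsManifold (𝓡 4) ((⊤ : ℕ∞) : WithTop ℕ∞) X],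
      X ≃ₕ 𝕊⁴ →
      (∃ (o : SmoothOrientation (𝓡 4) X) (f : X → 𝕊²) (L : Finset X),
          IsSimplifiedBrokenLefschetzFibration o f L 1) →
      Nonempty (Diffeomorph (𝓡 4) (𝓡 4) X 𝕊⁴ ((⊤ : ℕ∞) : WithTop ℕ∞)) := by
  intro X _ _ _ _ _ e hX
  obtain ⟨o, f, L, hf⟩ := hX
  obtain ⟨f₀, hf₀, y₀, hy₀, Ψ, hΨ⟩ := hA X e f ⟨o, L, hf⟩
  exact hR X e f ⟨o, L, hf⟩ f₀ hf₀ y₀ hy₀ Ψ hΨ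

/-- LADDER COMPOSITION (sorry-free implication): gap + rung ⇒ the crux `StepTwo`, through the landed
reduction `helper_stepTwo_of_genusTwoRecognition` and the PROVED Auroux–Donaldson–Katzarkov fibration
of the round sphere (`exists_sblf_genus_one_noLefschetz_sphere_four_holds`). [this file] -/
theorem stepTwo_of_regluing (hA : TorusRegluingOfSphereFour) (hR : TorusRegluingRecognition) :
    SblfDescent.StepTwo :=
  helper_stepTwo_of_genusTwoRecognition (genusTwoRecognition_of_regluing hA hR)
    exists_sblf_genus_one_noLefschetz_sphere_four_holds

end Summit.SmoothPoincare4.SmoothPoincare4.Cruxes.StepTwo.FibredRegluing
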